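import Mathlib
import HarnessLib
import Summits.QuantumFields.YangMills.Theses.ThermalRuler

/-!
# Route ThermalRuler — the glue `RulerFromCruxes` (item stmt-QuantumFields-11073)

`RulerFromCruxes : LinearDeconfinementWindow → QuantCentreRestoration → ThermalRulerBound` is pure
real arithmetic: the linear deconfinement window (item `LinearDeconfinementWindow`, Borgs–Seiler with
a threshold `J_E ≥ C₀·L₀`) at `d = 3` space dimensions produces Polyakov long-range order at temporal
extent `L₀ := ⌊β/C₀⌋₊` and couplings `(β, β)`, while the quantitative centre restoration (crux
`QuantCentreRestoration`) forbids it as soon as `A·log(βK₁/K₂)^a ≤ K₂⁴·L₀`; hence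
`K₂⁴·L₀ < A·log(βK₁/K₂)^a`, and `β < C₀(L₀+1) ≤ 2C₀L₀` gives `K₂⁴β < 2C₀A·log(βK₁/K₂)^a`. For
`2 ≤ β < 2C₀` the bound is trivial because `K₂ ≤ 1` and `log(βK₁/K₂) ≥ log 4 > 1`. The constant is
`C := 2C₀(A+1)` with the same exponent `a`.

No literature input beyond the two route items; no named facts.
-/

namespace Summit.QuantumFields.YangMills.Theorems

open Summit.QuantumFields.YangMills.Theses.ThermalRuler

/-- `1 ≤ log (β K₁ / K₂)` in the ruler's parameter range `2 ≤ β`, `2 ≤ K₁`, `0 < K₂ ≤ 1`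
(because `βK₁/K₂ ≥ 4 ≥ e`). -/
theorem thermalRuler_one_le_log {β K₁ K₂ : ℝ} (hβ : 2 ≤ β) (hK₁ : 2 ≤ K₁) (hK₂ : 0 < K₂)
    (hK₂1 : K₂ ≤ 1) : 1 ≤ Real.log (β * K₁ / K₂) := by
  have h4 : (4 : ℝ) ≤ β * K₁ / K₂ := by
    rw [le_div_iff₀ hK₂]
    nlinarith
  have hpos : 0 < β * K₁ / K₂ := lt_of_lt_of_le (by norm_num) h4
  rw [Real.le_log_iff_exp_le hpos]
  have he : Real.exp 1 < 2.7182818286 := Real.exp_one_lt_d9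
  linarith

/-- **Item stmt-QuantumFields-11073 (`RulerFromCruxes`).** The glue
`LinearDeconfinementWindow → QuantCentreRestoration → ThermalRulerBound` of route ThermalRuler:
with `C₀` the linear-window constant at `d = 3` and `(A, a)` the centre-restoration constants, the
thermal ruler bound holds with `C := 2C₀(A+1)` and the same exponent `a` (temporal extent
`L₀ := ⌊β/C₀⌋₊` when `β ≥ 2C₀`; trivial when `β < 2C₀`). -/
theorem rulerFromCruxes_proof :
    Summit.QuantumFields.YangMills.Theses.ThermalRuler.RulerFromCruxes := by
  intro hW hQ G _ _ _ _ _ _ _ _ n ρ z ω hn hρc hρu hz hω hρz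
  obtain ⟨C₀, hC₀, hwin⟩ := hW G n 3 ρ hρc hρu hn le_rfl
  obtain ⟨A, a, hA, hQ'⟩ := hQ G n ρ z ω hn hρc hρu hz hω hρz
  refine ⟨2 * C₀ * (A + 1), a, by positivity, ?_⟩
  intro β K₁ K₂ hβ hK₁ hK₂ hK₂1 hdec
  have hx : 1 ≤ Real.log (β * K₁ / K₂) := thermalRuler_one_le_log hβ hK₁ hK₂ hK₂1
  have hxa : 1 ≤ Real.log (β * K₁ / K₂) ^ a := one_le_pow₀ hx
  have hK₂4 : K₂ ^ 4 ≤ 1 := pow_le_one₀ hK₂.le hK₂1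
  have hK₂4pos : 0 < K₂ ^ 4 := by positivity
  have hCA : 0 ≤ 2 * C₀ * (A + 1) := by positivity
  by_cases hβC : β < 2 * C₀
  · -- small β: K₂⁴β ≤ β < 2C₀ ≤ 2C₀(A+1)·x^a
    have h1 : K₂ ^ 4 * β ≤ β := by nlinarith
    have h2 : 2 * C₀ * (A + 1) * 1 ≤ 2 * C₀ * (A + 1) * Real.log (β * K₁ / K₂) ^ a :=
      mul_le_mul_of_nonneg_left hxa hCA
    nlinarith
  · -- large β: run the ruler at temporal extent L₀ := ⌊β/C₀⌋₊
    push Not at hβC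
    have hβC' : 2 ≤ β / C₀ := by
      rw [le_div_iff₀ hC₀]
      linarith
    have hL₀2 : 2 ≤ ⌊β / C₀⌋₊ := Nat.le_floor (by exact_mod_cast hβC')
    haveI : NeZero ⌊β / C₀⌋₊ := ⟨by omega⟩
    have hfloor_le : (⌊β / C₀⌋₊ : ℝ) ≤ β / C₀ := Nat.floor_le (by positivity)
    have hlt_floor : β / C₀ < (⌊β / C₀⌋₊ : ℝ) + 1 := Nat.lt_floor_add_one _
    have hC₀L₀ : C₀ * (⌊β / C₀⌋₊ : ℝ) ≤ β := by
      rw [le_div_iff₀ hC₀] at hfloor_le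
      linarith
    have hβlt' : β < C₀ * ((⌊β / C₀⌋₊ : ℝ) + 1) := by
      rw [div_lt_iff₀ hC₀] at hlt_floor
      linarith
    have hL₀2' : (2 : ℝ) ≤ (⌊β / C₀⌋₊ : ℝ) := by exact_mod_cast hL₀2
    have hβlt : β < 2 * C₀ * (⌊β / C₀⌋₊ : ℝ) := by nlinarith
    -- Borgs–Seiler: Polyakov long-range order at (3, L₀, ρ, β, β)
    have hLRO := hwin ⌊β / C₀⌋₊ β β hC₀L₀ (by linarith)
    -- Chatterjee (quantitative): hence the restoration threshold is NOT met
    have hnot : ¬ (A * Real.log (β * K₁ / K₂) ^ a ≤ K₂ ^ 4 * (⌊β / C₀⌋₊ : ℝ)) :=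
      fun h => hQ' β K₁ K₂ hβ hK₁ hK₂ hK₂1 hdec ⌊β / C₀⌋₊ h hLRO
    push Not at hnot
    have h1 : K₂ ^ 4 * β < K₂ ^ 4 * (2 * C₀ * (⌊β / C₀⌋₊ : ℝ)) :=
      mul_lt_mul_of_pos_left hβlt hK₂4pos
    have h2 : 2 * C₀ * (K₂ ^ 4 * (⌊β / C₀⌋₊ : ℝ)) < 2 * C₀ * (A * Real.log (β * K₁ / K₂) ^ a) :=
      mul_lt_mul_of_pos_left hnot (by positivity)
    have h3 : 0 ≤ 2 * C₀ * Real.log (β * K₁ / K₂) ^ a := by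
      have : 0 ≤ Real.log (β * K₁ / K₂) ^ a := le_trans zero_le_one hxa
      positivity
    linarith

end Summit.QuantumFields.YangMills.Theorems
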